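import Mathlib
import HarnessLib
import HarnessLib.Audit
import Summits.ValiantsHypothesis.Statement
import HarnessLib.Audit.Status.Attr

/-!
Route: LacunarySymmetroid

# Route LacunarySymmetroid — matrix Descartes rule — real-zero counting reopened for lacunary
symmetric determinants, the TauRealZeros wall minus squaring

BARRIER INVERSION of `Literature.Barriers.ValiantsHypothesis.TauRealZeros` (Chebyshev: τ(T_{2^k}) =
O(k), 2^k real zeros; tree
`tauRealZeros_holds`). The wall's witness uses exactly one property of τ: closure under p ↦ 2p² − 1
at ADDITIVE cost (squaring of
intermediate results). Skew classes — determinants of affine pencils, the normal form of VP up to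
quasi-polynomial size — square only at
MULTIPLICATIVE cost, so real-zero counting is reopened there. It suffices to show X = MDR ∧
PencilTransfer ∧ ThetaWitness (card
lacunary-symmetroid-descartes, spine and only card; MDR = its K1 "needed form"): MDR (the DOOR) — a
real symmetric m×m pencil
Σ_{l<K} X^{d_l} S_l with K lacunary terms and m quasi-polynomial in K has Z = 2^{o(K log K)}
distinct real zeros of its determinant
(typed: ∀ c q, eventually in K, m ≤ 2^{(log₂K + c)^c} ⇒ Z^q ≤ 2^{K log₂ K}); PencilTransfer — along
every monomial curve y_i = X^{d_i} a
real VP family is, up to the real zero SET, the determinant of such a pencil with K = #vars + 1;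
ThetaWitness — some n-variate VNP family
has 2^{n log₂ n} − 1 real zeros along a monomial curve (base-n theta digits). Under VP = VNP the
witness is VP, the pencil exists, and MDR
caps its zeros at 2^{(n+1)log(n+1)/4}: contradiction.
Lean: `MatrixDescartes ∧ PencilTransfer ∧ ThetaWitness` where `MatrixDescartes := ∀ c q : ℕ, 0 < q →
∃ K₀ : ℕ, ∀ K m : ℕ, K₀ ≤ K → m ≤ 2 ^ ((Nat.log 2 K + c) ^ c) → ∀ (d : Fin K → ℕ) (S : Fin K →
Matrix (Fin m) (Fin m) ℝ), (∀ l, (S l).IsSymm) → (Matrix.det (∑ l, ((Polynomial.X : Polynomial ℝ) ^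
d l) • (S l).map Polynomial.C)).roots.toFinset.card ^ q ≤ 2 ^ (K * Nat.log 2 K)`

## Assembly
Pure logic plus ℕ-arithmetic, certified in glue.lean (`closes hMDR hT hW : ValiantsHypothesis`, 60
lines, sorry-free): VH unfolds to
VP ℂ ≠ VNP ℂ; if VP ℂ = VNP ℂ, the witness Θ (ThetaWitness) is a VNP hence VP family
(`mem_VNP_ofFintype_iff_holds`,
`mem_VP_ofFintype_iff_holds`); PencilTransfer with v(n) = n gives c and, for every n, a symmetric
pencil with K = n+1 terms, size
m ≤ 2^{(log n + c)^c} ≤ 2^{(log(n+1) + c)^c} and the same real zero set; MDR at (c, q = 4) gives K₀;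
at n = n₀ + K₀ + 4 one gets
Z⁴ ≤ 2^{(n+1)⌊log₂(n+1)⌋} ≤ 2^{(n+1)(L+1)} and Z + 1 ≥ 2^{nL} (L = ⌊log₂n⌋ ≥ 2), i.e. 4(nL−1) ≤
(n+1)(L+1), i.e. 3nL ≤ n+L+5 with L ≤ n,
n ≥ 4 — false. All three cruxes are load-bearing binders of `closes`.

Rationale: WHY THIS LINE. The wall TauRealZeros is typed in the tree as `RealZeroTauBound c` — real-zero counts
against the constant-free gate count of GENERAL
straight-line programs — and its catalogued evasions are "restrict DEPTH" (Koiran2011 §6 Conj. 3,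
real τ for ΣΠΣ-sparse; route-less
but in Literature), "change the PLACE" (KoiranPortierTavenasThomasse2015 Newton polygons: routes
NewtonFrames/NewtonUnitEquations;
Phillipson–Rojas adelic) and "count INTEGER zeros" (route TauConst). Nobody on this summit restricts
FAN-OUT: the lacunary-pencil format
(m, K) charges the Chebyshev tower T_{2^r}(S₀ + X S₁) either K = 2^r + 1 terms or size m ≥ 2^r
(support TwoTermSector), so the wall's
own witness sits at log Z ≤ log m + log K and does not enter the class cheaply. Imported areas:
spectral theory of symmetric matrix
pencils (eigenvalue branches are Rayleigh K-nomials; Cauchy interlacing under compression;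
definite/hyperbolic pencils, where a matrix
Descartes rule is a THEOREM — Cameron–Psarrakos, doi:10.7153/oam-2019-13-48 Thm 3, Markus' spectral
zones), fewnomial theory
(Descartes/Khovanskii: the trivial bound log Z ≤ K·(log₂K + c)^c that MDR must shave), polyhedral
shadows of Birkhoff polytopes (the
cancellation-free envelope Z_trop of the card = parametric assignment breakpoints), and the
Koiran–Tavenas transfer with Tavenas'
P-definable Hutchinson witness (Tavenas2014 Lemme 3.36, tree `TavenasHutchinsonFamily`) re-based
from bits to base-n digits so that the
pencil route — which, unlike depth reduction, loses NO √degree — needs only the o(K log K) rate. No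
route of the 57 open ones counts real
zeros of restrictions of VP families or touches lacunary determinants (nearest: TauConst integer
roots; ContractivityPrice zero-FREE
polydiscs of det(I−KZ)); the negatives index (UlrichPadded/GrenetRigidity gauge twists, Elusive
Sidon curve) is untouched.

RANKED CRUXES. #2 MatrixDescartes (crux) — MDR, needed form (card K1): for all c, q there is K₀ such
that for every K ≥ K₀, every m ≤ 2^{(⌊log₂K⌋ + c)^c}, all exponents d : Fin K → ℕ and all real
symmetric m×m matrices S_l, the number Z of distinct real zeros of det(Σ_l X^{d_l} S_l) satisfies
Z^q ≤ 2^{K⌊log₂K⌋} — log Z = o(K log K) uniformly in quasi-polynomial size. [difficulty: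
open-problem] (why it might fail: the wall may extend to the escaped clause: symmetroids could
realise Descartes-sharp sign patterns along moment curves (log Z ≍ K log m); cheapest falsifier =
extend the refuting witness: T_{2^r} as a poly(r)-size lacunary symmetric det, or big Birkhoff
shadows with O(log m) slopes.) [Koiran2011, KoiranPortierTavenas2015, doi:10.7153/oam-2019-13-48,
BriquelBurgisser2020, Tavenas2014]
#3 PencilTransfer (crux) — for every real polynomial family f_n in v(n) variables whose
complexification is a VP family and every exponent vectors d_n, there is c such that for all n some
real SYMMETRIC pencil with v(n)+1 lacunary terms (exponents 0, d_{n,0}, …) and size m ≤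
2^{(⌊log₂n⌋+c)^c} has det with the same SET of real zeros as f_n(X^{d_{n,0}}, …, X^{d_{n,v(n)-1}}).
Chain: VP ⇒ dc quasi-polynomial (tree `isQPBounded_determinantalComplexity_of_isVPFamily_holds`,
attained by `hasDetRepr_determinantalComplexity_holds`) ⇒ complex affine pencil ⇒ substitute ⇒
realify ρ(B+iC) = [[B,−C],[C,B]] (det = F·F̄ = F²) ⇒ symmetric doubling [[0,R],[Rᵀ,0]] (det = F⁴,
size 4m). [difficulty: M] (why it might fail: a theorem chain in print (Valiant universality + VSBR,
realification, symmetric doubling): it can fail only AS TYPED — qp exponent stated in n not v(n)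
(fine for v(n) ≤ n, the only use); zero-SET equality needs det = F⁴ exactly; a size slip (4m) forces
a restatement, not a retreat.) [Valiant1979, Burgisser2000, BurgisserClausenShokrollahi1997,
arXiv:1007.3804]
#4 ThetaWitness (crux) — some real family Θ_n in n variables with VNP complexification and some
exponents d_n have, eventually, at least 2^{n⌊log₂n⌋} − 1 distinct real zeros of Θ_n(X^{d_{n,i}}).
Intended witness (birth file): B = 2^{⌊log₂n⌋}, Θ_n = Σ_{e∈[B]^n} (−1)^{k(e)} 2^{−2k(e)²} Π
y_i^{e_i}, k(e) = Σ e_i B^i, d_{n,i} = 4B^i, restriction Σ_{k<B^n} (−1)^k 2^{−2k²} X^{4k} with sign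
(−1)^j at X = 2^j (dominant term; Hutchinson ratio 16) — Tavenas' P-definable family re-based from
bits to digits, VNP by the bit-pair product 2^{−2k²} = Π (2^{−2·2^{a+b}B^{i+j}})^{bit·bit}
(constants free). [difficulty: L] (why it might fail: in print for base 2 (Tavenas2014 Lemme 3.36,
tree `tavenasV`, rate 2^n); the base-n version needs `IsVNPFamily` with constants of
doubly-exponential height 2^{−2^{a+b+1}n^{i+j}} — legal (Burgisser2000 Def 2.5, constants free) but
the Boolean-sum family g_n must be written out: bookkeeping risk.) [Tavenas2014,
KoiranPortierTavenasThomasse2015, Hutchinson1923, Burgisser2000]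
#9 OneTermSector (support) — the one-term format K = 1 of MDR (card sector (a)): det(X^e S) = X^{em}
det S has at most the real zero 0 — PROVED sorry-free in the planner folder (bc/Special.lean,
`oneTermSector`, `matrixDescartes_K_one`); filed so the format's Lean rendering is exercised in the
tree. [difficulty: provable-now] [Koiran2011]
#9 TwoTermSector (support) — the two-term format (card sector (a), K = 2; the WALL CERTIFICATE in
the new format): det(S₀ + X^e S₁) = p(X^e) with deg p ≤ m, so at most 2m + 1 distinct real zeros;
consequently the Chebyshev tower T_{2^r}(S₀ + X S₁) of the barrier file (`chebyshevT`,
`card_realRoots_chebyshevT`) forces m ≥ 2^{r−1}: the refuting witness of TauRealZeros costs size or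
terms, never gates, in the (m, K) format. [difficulty: provable-now] [Koiran2011,
doi:10.7153/oam-2019-13-48]

TWO-LAYER PLAN. Foreseen glued splits (filed later, k ≤ 3, depth 1): MatrixDescartes ⇐
DescartesPencil (Z ≤ 2(m+K)^m + 1, provable: ≤ C(m+K−1,m) distinct
exponents + Descartes' rule) → CoreLargeFormats (MDR on K < m(⌊log₂(m+K)⌋+1)) → MatrixDescartes (the
composition with its arithmetic is
ALREADY proved: bc/MatrixDescartes_birth.lean); CoreLargeFormats ⇐ EigenframeBound (Z ≤ m +
quarter-turns of the spectral frame, card K4)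
→ FrameVariationDiminishing (quarter-turns ≤ poly(m)·2^{o(K log K)}) → Core; PencilTransfer ⇐
AffinePencil (VP ⇒ complex affine lacunary
pencil, det = complexified restriction) → RealSymmetrise (complex pencil with real det F ⇒ real
symmetric 4m-pencil, det = F⁴) →
PencilTransfer (composition proved: bc/PencilTransfer_birth.lean); ThetaWitness ⇐ ThetaVNP →
ThetaRoots → ThetaWitness (bc/ThetaWitness_birth.lean).

KILL CRITERIA. A lacunary symmetric pencil family with Z ≥ 2^{εK log K} at m ≤ 2^{polylog K} for
some fixed (c, ε) and infinitely many K refutes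
MatrixDescartes outright — close `refuted:MatrixDescartes`, and the witness (a squaring-free
real-root monster) goes to
Literature/Barriers/ValiantsHypothesis as the extension of TauRealZeros to skew classes (informative
either way: it would show fan-out is
NOT what Chebyshev needs). In particular T_{2^r} (or the dilated Dickson `dilDickson` of the barrier
file) written as a poly(r)-size
lacunary symmetric determinant kills the line. A refutation of the card's necessary shadow statement
(2-D shadows of Birkhoff polytopes
B_m along K slope classes with 2^{Ω(K log K)} lower vertices at log m = O(log²K)) kills MDR through
patchworking — pivot impossible, close.
PencilTransfer/ThetaWitness can only be MIS-typed, not false: repair by restatement (constants 4m /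
n₀), never a pivot. KoiranRealTauConjecture
proved elsewhere does NOT moot the route (it gives VP⁰ ≠ VNP⁰ only); VH proved elsewhere moots it.

NOT DECOMPOSED YET. The spectral engine (eigenvalue branches as Rayleigh K-nomials,
Hellmann–Feynman, interlacing/compression induction with global index
bookkeeping — card K4), the first genuinely multiplicative format K = 4 (real symmetroid surfaces
met by (1:t^a:t^b:t^c), card K3), the
tropical envelope Z_trop (Birkhoff shadows / parametric assignment, card K2) and Descartes' rule for
pencils (DescartesPencil) are layer-2
children of MatrixDescartes; the positive/negative-root symmetry X ↦ −X (S_l ↦ (−1)^{d_l} S_l) and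
the regime bookkeeping n ↔ K = n+1 are
absorbed in the statements; constant-freeness is irrelevant (constants are free throughout, no
counting hierarchy, no GRH).

CHEAPEST FALSIFIER. (i) LOOKUP/CONSTRUCTION: express T_{2^r} — or any degree-2^{O(r)} real
polynomial with 2^r real zeros — as det of a poly(r)-size real
symmetric matrix with poly(r) lacunary terms (the card's author tried diagonal, block, companion
p∘q, Horner towers, Sylvester resultants:
all give Z = O(size·K); TwoTermSector proves K = 2 needs m ≥ 2^{r−1}); (ii) NUMERICS (kit, one
batched job): hill-climb max Z over random
symmetric formats (m, K) ∈ {(3,3),(4,4),(6,4),(8,5)} by Sturm sequences and compare with K·m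
(additive) vs C(m+K−1,m) (multiplicative) —
the card's jobs j003256 ((2,3): max 4 = m(K−1) vs trivial 5), j003267/j003268/j003365/j003366 were
queued at filing; (iii) LIBRARY: do the
Carstensen 1983 / Mulmuley–Shah 2001 parametric-shortest-path instances with m^{Ω(log m)}
breakpoints use only O(log m) distinct slopes?
(kills the card's bold additive form, not the needed form). I ran none of (ii)–(iii) this cycle (no
kit in this seat's brief); (i) was
re-derived by hand for K = 2 (TwoTermSector) and is the refuter's first move.

NUMBERS. Trivial (Descartes on distinct exponents): Z ≤ 2·C(m+K−1, m) − 1, i.e. log₂ Z ≤ K·(log₂K +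
c)^c in the regime — MDR must shave this to
o(K log K). Proved sectors (card, page-level sources): K = 1: Z ≤ 1 (OneTermSector, proved here); K
= 2: Z ≤ 2m+1 (TwoTermSector); PSD
higher terms (Loewner): Z ≤ m for every K; definite/hyperbolic pencils: Z ≤ m(K−1)
(doi:10.7153/oam-2019-13-48 Thm 3; Markus 1988);
commuting S_l: Z ≤ m(2K−1); fixed m: Z ≤ poly_m(K) by KoiranPortierTavenas2015 Thm 12 (Σ_{i≤k}Π_j
f_j^{α_ij} has ≤ 4ktm + 4(e(1+t))^{mk²/2}
real zeros; m = 2: three squares). Witness side: base-n theta digits give log₂ Z = n⌊log₂ n⌋ ≈ (K−1)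
log₂(K−1) at K = n+1 and
log₂ m = O(log² n) — the MAXIMAL rate for n-variate p-families on monomial curves (≤ n log(deg)), so
o(K log K) is the weakest door of this
shape; Tavenas' base-2 family (tree `tavenasV`: 2^n − 1 zeros, K = 2n+4) would need the stronger
o(K). Chebyshev in format: T_{2^r}(S₀+XS₁)
has K = 2^r + 1. Items at open: 6 (3 cruxes, 2 supports, 1 assembly).

DEFINITION REQUESTS. (1) BARRIER THEOREM candidate (lens output (a)), to be filed as `ledger
workitem add --kind definition --notion TauRealZerosSquaringTyped
--topic Literature/Barriers/ValiantsHypothesis`: "for every measure μ : ℤ[X] → ℕ with μ(X) ≤ a and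
μ(2p² − 1) ≤ μ(p) + a there are p_k with
μ(p_k) ≤ a(k+1) and 2^k distinct real zeros" — the wall typed by its ONE load-bearing hypothesis
(additive-cost squaring), provable now from
`chebyshevT_succ` / `card_realRoots_chebyshevT`; it makes precise that RealZeroTauBound fails for
every squaring-cheap measure and says
nothing about the (m, K) pencil format. (2) Optional notions (statements currently inline them):
`lacunaryPencilDet d S : ℝ[X]` and
`realZeroCount p := p.roots.toFinset.card` under Literature/Computability/AlgebraicComplexity (or
LinearAlgebra/MatrixPencils).

Novelty: Searches (2026-08-17): `lit search --hybrid "Descartes rule of signs for matrix polynomials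
hyperbolic" --source local` (10 book hits, none on
lacunary pencils: Basu–Pollack–Roy, Braess, Bernstein Matrix Mathematics); `lit search --source
zbmath "Descartes rule of signs matrix
polynomials"` (6: Cameron–Psarrakos 2019 doi:10.7153/oam-2019-13-48 the only relevant;
Bihan–Dickenstein–Forsgård 2021 circuits);
`lit search --source zbmath "number of real eigenvalues matrix polynomial few terms lacunary
Descartes"` (0); `lit search --source arxiv
"real roots sums of products of sparse polynomials tau conjecture"` (0 — service degraded;
openalex/s2 rate-limited 429);
`lit galaxy search "real eigenvalues of matrix polynomials" --star all` (0), `"Descartes rule of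
signs" --star pdf` (15, all irrelevant);
`lit read arxiv:1004.4960 --grep "Conjecture 3|Chebyshev"` (p.3 L51 the Chebyshev obstruction, p.11
L30 Conj. 3); tree: Barriers/TauRealZeros
(evasions_known list: depth, place, integer — no fan-out/skew entry), RealTauConjectureViaVn +
TavenasHutchinsonFamily + TavenasVnWitness
(the base-2 witness and transfer), VPDeterminantalQP; all 57 open/done route headers of the sub
(lever list in NOTES) and 120 cards; the
card's own mechanism-critic audit (refuter-mechcritic-2280, 2026-08-16: zbMATH 'Descartes rule
matrix polynomial' → only Cameron–Psarrakos;
'real zeros determinant sparse entries' 0; galaxy real-tau → MFCS15 only; grade new-combination,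
elegance high).
Nearest prior art found:  [refs: 10.7153/oam-2019-13-48, 1004.4960, 1007.3804, doi:10.7153/oam-2019-13-48, arxiv:1004.4960, Koiran2011, Tavenas2014]

Barriers (technique_class: real-root-counting, lacunary-pencils, barrier-inversion): - technique_class: real-root-counting, lacunary-pencils, barrier-inversion
- Literature.Barriers.ValiantsHypothesis.TauRealZeros: THE wall inverted. Escaped hypothesis, by
name: the technique class `RealZeroTauBound c` measures τ = `constantFreeComplexity` of GENERAL
fan-in-two programs, closed under p ↦ 2p²−1 at cost +3 (`chebyshevCircuit`,
`constantFreeComplexity_chebyshevT_le`); MDR measures the lacunary-pencil format (m, K), in which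
the same tower costs K = 2^r+1 or m ≥ 2^{r−1} (TwoTermSector) — the audit's strengthenings
(`not_realZeroBound_quasipoly`, `not_separatedRealZeroTauBound`, dilated Dickson) all live in the
general class and do not touch the format; honest bet: every real-root explosion needs squaring of
intermediate results, which determinants/ABPs cannot do.
- Literature.Barriers.ValiantsHypothesis.AlgebraicNaturalProofs: not in the class — a bound on real
zeros of restrictions to curves with exponentially large exponents is an archimedean, semialgebraic,
degree-unbounded statement, not a poly(N)-size polynomial vanishing on coefficient vectors of VP_N
(FSV Def. 1); largeness comes from lacunarity; the barrier is conditional anyway and nothing is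
claimed either way.
- Literature.Barriers.ValiantsHypothesis.PermanentCharTwo: consistent — MDR uses the ORDER of ℝ and
the assembly is over ℂ (char 0); nothing characteristic-free is asserted (in char 2 per = det and
ThetaWitness/PencilTransfer have no analogue).
- Literature.Barriers.ValiantsHypothesis.DepthReduct

History (route lifecycle, newest last):
- 2026-08-24T19:57:14Z · DORMANT — reconciler: no traction for 7 d (last activity item-evidence-added at 2026-08-17T18:44:22Z); parked, not closed — `ledger route dormant route-ValiantsHypothesis (operator:999:3442071)
- 2026-08-25T13:33:38Z · REACTIVATED — D-0041 (B) (decisions/DECISIONS.md l.57; portfolio coordinator 21-frontier 2026-08-25T13:14:02Z): re-activated so pub-symmetroid landings register as route evid (operator:999:2195708)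
- 2026-08-25T13:57:19Z · DORMANT — reconciler: no traction for 7.8 d (last activity item-evidence-added at 2026-08-17T18:44:22Z); parked, not closed — `ledger route dormant route-ValiantsHypothes (operator:999:3266644)
- 2026-08-25T16:20:28Z · REACTIVATED — dormant cleared (operator:999:3506013)
- 2026-08-25T17:24:02Z · DORMANT — reconciler: no traction for 7.9 d (last activity item-evidence-added at 2026-08-17T18:44:22Z); parked, not closed — `ledger route dormant route-ValiantsHypothes (operator:999:1971736)
- 2026-08-25T23:11:00Z · REACTIVATED — reactivated operator-side on director-valiant 23:08:15Z (D-0059 V1/V2a ledger home; the symmetroid desk was refused by role) (operator:999:3854215)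

sub-problem: ValiantsHypothesis · status: open · opened planner-plan-lens3-ValiantsHypothesis-barrier-0 2026-08-17T02:19:18Z · rev 3 · ledger route-ValiantsHypothesis-LacunarySymmetroid
GENERATED by the gate from the ledger (D-0016/17). Provers cite these decls: `theorem foo : Summit.ValiantsHypothesis.ValiantsHypothesis.Theses.LacunarySymmetroid.<Decl> := …` in Summits/ValiantsHypothesis/ValiantsHypothesis/Theorems/<Name>.lean.
-/

namespace Summit.ValiantsHypothesis.ValiantsHypothesis.Theses.LacunarySymmetroid

open scoped BigOperators Topology Manifold Classical MeasureTheory ProbabilityTheory Matrix InnerProductSpace ComplexConjugate ContinuousMap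
open Filter Set Function TopologicalSpace MeasureTheory

attribute [summit_statement] _root_.ValiantsHypothesis

open Literature.PNP

/-- item stmt-ValiantsHypothesis-18050 · crux · rank 2 · open · by planner
why it might fail: the wall may extend to the escaped clause: symmetroids could realise Descartes-sharp sign patterns along moment curves (log Z ≍ K log m); cheapest falsifier = extend the refuting witness: T_{2^r} as a poly(r)-size lacunary symmetric det, or big Birkhoff shadows with O(log m) slopes.
sources: Koiran2011, KoiranPortierTavenas2015, doi:10.7153/oam-2019-13-48, BriquelBurgisser2020, Tavenas2014
[crux] MDR, needed form (card K1): for all c, q there is K₀ such that for every K ≥ K₀, every m ≤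
2^{(⌊log₂K⌋ + c)^c}, all exponents d : Fin K → ℕ and all real symmetric m×m matrices S_l, the number
Z of distinct real zeros of det(Σ_l X^{d_l} S_l) satisfies Z^q ≤ 2^{K⌊log₂K⌋} — log Z = o(K log K)
uniformly in quasi-polynomial size. [difficulty: open-problem] -/
@[route_item "route-ValiantsHypothesis-LacunarySymmetroid", crux (experiment := "instrument: - Plain words: nobody has a method that turns any of the proved special cases into a statement about ALL polynomial-size circuits. The fund…") (source := "director Valiant l.87, 2026-09-01")]
def MatrixDescartes : Prop :=
  ∀ c q : ℕ, 0 < q → ∃ K₀ : ℕ, ∀ K m : ℕ, K₀ ≤ K → m ≤ 2 ^ ((Nat.log 2 K + c) ^ c) → ∀ (d : Fin K → ℕ) (S : Fin K → Matrix (Fin m) (Fin m) ℝ), (∀ l, (S l).IsSymm) → (Matrix.det (∑ l, ((Polynomial.X : Polynomial ℝ) ^ d l) • (S l).map Polynomial.C)).roots.toFinset.card ^ q ≤ 2 ^ (K * Nat.log 2 K)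

/-- item stmt-ValiantsHypothesis-18051 · crux · rank 3 · closed · proved by Summit.ValiantsHypothesis.ValiantsHypothesis.Theorems.LacunarySymmetroid.pencilTransfer_proof @ 5bb5ed5ec49d (prover) · by planner
why it might fail: a theorem chain in print (Valiant universality + VSBR, realification, symmetric doubling): it can fail only AS TYPED — qp exponent stated in n not v(n) (fine for v(n) ≤ n, the only use); zero-SET equality needs det = F⁴ exactly; a size slip (4m) forces a restatement, not a retreat.
sources: Valiant1979, Burgisser2000, BurgisserClausenShokrollahi1997, arXiv:1007.3804
[crux] for every real polynomial family f_n in v(n) variables whose complexification is a VP family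
and every exponent vectors d_n, there is c such that for all n some real SYMMETRIC pencil with
v(n)+1 lacunary terms (exponents 0, d_{n,0}, …) and size m ≤ 2^{(⌊log₂n⌋+c)^c} has det with the same
SET of real zeros as f_n(X^{d_{n,0}}, …, X^{d_{n,v(n)-1}}). Chain: VP ⇒ dc quasi-polynomial (tree
`isQPBounded_determinantalComplexity_of_isVPFamily_holds`, attained by
`hasDetRepr_determinantalComplexity_holds`) ⇒ complex affine pencil ⇒ substitute ⇒ realify ρ(B+iC) =
[[B,−C],[C,B]] (det = F·F̄ = F²) ⇒ symmetric doubling [[0,R],[Rᵀ,0]] (det = F⁴, size 4m).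
[difficulty: M] -/
@[route_item "route-ValiantsHypothesis-LacunarySymmetroid", crux]
def PencilTransfer : Prop :=
  ∀ (v : ℕ → ℕ) (f : ∀ n, MvPolynomial (Fin (v n)) ℝ), Literature.Computability.AlgebraicComplexity.IsVPFamily (fun n => MvPolynomial.map (algebraMap ℝ ℂ) (f n)) → ∀ d : (n : ℕ) → Fin (v n) → ℕ, ∃ c : ℕ, ∀ n : ℕ, ∃ m : ℕ, m ≤ 2 ^ ((Nat.log 2 n + c) ^ c) ∧ ∃ S : Fin (v n + 1) → Matrix (Fin m) (Fin m) ℝ, (∀ l, (S l).IsSymm) ∧ (Matrix.det (∑ l, ((Polynomial.X : Polynomial ℝ) ^ (Fin.cons (α := fun _ => ℕ) (0 : ℕ) (d n) l)) • (S l).map Polynomial.C)).roots.toFinset = (MvPolynomial.aeval (fun i => (Polynomial.X : Polynomial ℝ) ^ d n i) (f n)).roots.toFinset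

/-- item stmt-ValiantsHypothesis-18052 · crux · rank 4 · closed · proved by Summit.ValiantsHypothesis.ValiantsHypothesis.Theorems.LacunarySymmetroid.thetaWitness_proof @ c53605aacd50 (prover) · by planner
why it might fail: in print for base 2 (Tavenas2014 Lemme 3.36, tree `tavenasV`, rate 2^n); the base-n version needs `IsVNPFamily` with constants of doubly-exponential height 2^{−2^{a+b+1}n^{i+j}} — legal (Burgisser2000 Def 2.5, constants free) but the Boolean-sum family g_n must be written out: bookkeeping risk.
sources: Tavenas2014, KoiranPortierTavenasThomasse2015, Hutchinson1923, Burgisser2000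
[crux] some real family Θ_n in n variables with VNP complexification and some exponents d_n have,
eventually, at least 2^{n⌊log₂n⌋} − 1 distinct real zeros of Θ_n(X^{d_{n,i}}). Intended witness
(birth file): B = 2^{⌊log₂n⌋}, Θ_n = Σ_{e∈[B]^n} (−1)^{k(e)} 2^{−2k(e)²} Π y_i^{e_i}, k(e) = Σ e_i
B^i, d_{n,i} = 4B^i, restriction Σ_{k<B^n} (−1)^k 2^{−2k²} X^{4k} with sign (−1)^j at X = 2^j
(dominant term; Hutchinson ratio 16) — Tavenas' P-definable family re-based from bits to digits, VNP
by the bit-pair product 2^{−2k²} = Π (2^{−2·2^{a+b}B^{i+j}})^{bit·bit} (constants free).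
[difficulty: L] -/
@[route_item "route-ValiantsHypothesis-LacunarySymmetroid", crux]
def ThetaWitness : Prop :=
  ∃ (Θ : ∀ n : ℕ, MvPolynomial (Fin n) ℝ) (d : ∀ n : ℕ, Fin n → ℕ), Literature.Computability.AlgebraicComplexity.IsVNPFamily (fun n => MvPolynomial.map (algebraMap ℝ ℂ) (Θ n)) ∧ ∃ n₀ : ℕ, ∀ n : ℕ, n₀ ≤ n → 2 ^ (n * Nat.log 2 n) ≤ (MvPolynomial.aeval (fun i => (Polynomial.X : Polynomial ℝ) ^ d n i) (Θ n)).roots.toFinset.card + 1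

/-- item stmt-ValiantsHypothesis-18053 · support · rank 9 · closed · proved by Summit.ValiantsHypothesis.ValiantsHypothesis.Theorems.LacunarySymmetroid.oneTermSector_proof @ 5b161b4eb82d (prover) · by planner
sources: Koiran2011
[support] the one-term format K = 1 of MDR (card sector (a)): det(X^e S) = X^{em} det S has at most
the real zero 0 — PROVED sorry-free in the planner folder (bc/Special.lean, `oneTermSector`,
`matrixDescartes_K_one`); filed so the format's Lean rendering is exercised in the tree.
[difficulty: provable-now] -/
@[route_item "route-ValiantsHypothesis-LacunarySymmetroid"]
def OneTermSector : Prop :=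
  ∀ (m e : ℕ) (S : Matrix (Fin m) (Fin m) ℝ), (Matrix.det (((Polynomial.X : Polynomial ℝ) ^ e) • S.map Polynomial.C)).roots.toFinset.card ≤ 1

/-- item stmt-ValiantsHypothesis-18054 · support · rank 9 · closed · proved by Summit.ValiantsHypothesis.ValiantsHypothesis.Theorems.twoTermSector_proof @ 415767276024 (prover) · by planner
sources: Koiran2011, doi:10.7153/oam-2019-13-48
[support] the two-term format (card sector (a), K = 2; the WALL CERTIFICATE in the new format):
det(S₀ + X^e S₁) = p(X^e) with deg p ≤ m, so at most 2m + 1 distinct real zeros; consequently the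
Chebyshev tower T_{2^r}(S₀ + X S₁) of the barrier file (`chebyshevT`, `card_realRoots_chebyshevT`)
forces m ≥ 2^{r−1}: the refuting witness of TauRealZeros costs size or terms, never gates, in the
(m, K) format. [difficulty: provable-now] -/
@[route_item "route-ValiantsHypothesis-LacunarySymmetroid"]
def TwoTermSector : Prop :=
  ∀ (m e : ℕ) (S₀ S₁ : Matrix (Fin m) (Fin m) ℝ), (Matrix.det (S₀.map Polynomial.C + ((Polynomial.X : Polynomial ℝ) ^ e) • S₁.map Polynomial.C)).roots.toFinset.card ≤ 2 * m + 1

/-- item stmt-ValiantsHypothesis-19979 · support · rank 9 · open · by operator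
[support] DOOR A at format (2,6) — the cell pub-symmetroid standalone theorem TARGET (K1, lead g5
K1-PENCILTRANSFER-ANSWER.md §3; ledger home per D-0059 V2a, director-valiant 2026-08-25 / desk R1224
(3)): every 6-term real symmetric 2×2 lacunary pencil det(Σ_l X^{d_l} S_l) has at most 19 = D(2,6) −
1 distinct positive real zeros (ζ_sym(2,6) ≤ 19), i.e. `PosRootLawAt 2 6 19` unfolded — equal by
`Iff.rfl` to the typed target
`Summit.ValiantsHypothesis.ValiantsHypothesis.Theorems.LacunarySymmetroidMatrixDescartes.DoorA26`
(…CensusDefs; `doorA26_iff` in …CensusDoorA); a one-line Theorems link is landed --supports this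
item so a proof of either name closes it. Status of record 2026-08-25: OPEN, never asserted. Kernel:
18 ≤ ζ_sym(2,6) ≤ 20 (`Census.k1_baseline`, `Census.bounds_2_6`); ≤ 19 proved support-by-support
only (record supports `ub19_on_2_6_record_supports`, sign-class supports, uniform rays …TNCUnif*,
BOX20 replays — all V = 20 layer); a format-level / chamber reduction is ABSENT. Census FREEZE OF
RECORD 92eee4f14f2df36a, 228/228, maximum 18, never > 18 (finite evidence, decides nothing).
Refutable by ONE pencil with 20 distinct positive det-roots (`not_doorA26_iff`). Does NOT i -/
@[route_item "route-ValiantsHypothesis-LacunarySymmetroid"]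
def DoorA26 : Prop :=
  ∀ (d : Fin 6 → ℕ) (S : Fin 6 → Matrix (Fin 2) (Fin 2) ℝ), (∀ l, (S l).IsSymm) → ((∑ l, (Polynomial.X : Polynomial ℝ) ^ d l • (S l).map Polynomial.C).det.roots.toFinset.filter (fun t => 0 < t)).card ≤ 19

/-- item stmt-ValiantsHypothesis-19980 · support · rank 9 · open · by operator
[support] DOOR A companion at format (3,4) — the cell pub-symmetroid standalone theorem TARGET (same
provenance as DoorA26; ledger home per D-0059 V2a): every 4-term real symmetric 3×3 lacunary pencil
det(Σ_l X^{d_l} S_l) has at most 18 = D(3,4) − 1 distinct positive real zeros (ζ_sym(3,4) ≤ 18; the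
non-symmetric control value is 19 = D, `Census.G3K4E1.card_posRoots_eq`), i.e. `PosRootLawAt 3 4 18`
unfolded — equal by `Iff.rfl` to
`Summit.ValiantsHypothesis.ValiantsHypothesis.Theorems.LacunarySymmetroidMatrixDescartes.DoorA34`
(…CensusDefs; `doorA34_iff`); link theorem landed --supports this item. Status of record 2026-08-25:
OPEN, never asserted. Kernel: 18 ≤ ζ_sym(3,4) ≤ 19 (`Census.bounds_3_4`, so DoorA34 ↔ ζ_sym(3,4) =
18, `doorA34_iff_register`); no support-level upper-bound certificate below D exists at (3,4) in the
kernel. Census FREEZE OF RECORD 92eee4f14f2df36a: register ζ_sym(3,4) ∈ {18,19}, 18 attained, never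
> 18 (finite evidence, decides nothing). Refutable by ONE symmetric pencil with 19 distinct positive
det-roots (`not_doorA34_iff`; WAKE protocol R744). Does NOT imply MatrixDescartes
(stmt-ValiantsHypothesis-18050) and is not implied by it; no bearing on VP ≠ VNP. w -/
@[route_item "route-ValiantsHypothesis-LacunarySymmetroid"]
def DoorA34 : Prop :=
  ∀ (d : Fin 4 → ℕ) (S : Fin 4 → Matrix (Fin 3) (Fin 3) ℝ), (∀ l, (S l).IsSymm) → ((∑ l, (Polynomial.X : Polynomial ℝ) ^ d l • (S l).map Polynomial.C).det.roots.toFinset.filter (fun t => 0 < t)).card ≤ 18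

/-- item stmt-ValiantsHypothesis-18055 · assembly · rank 1 · closed · proved by Summit.ValiantsHypothesis.ValiantsHypothesis.Theorems.lacunarySymmetroid_assembly_proof @ 6251b66eea06 (prover) · by planner
sources: Koiran2011, Tavenas2014, Burgisser2000
[assembly] MatrixDescartes → PencilTransfer → ThetaWitness → VP_ℂ ≠ VNP_ℂ. -/
@[route_item "route-ValiantsHypothesis-LacunarySymmetroid"]
def Assembly : Prop :=
  MatrixDescartes → PencilTransfer → ThetaWitness → _root_.ValiantsHypothesis

/-! D-0027 §2.1 — DECIDING THEOREM (planner-authored via `route open/edit --closes-file`; by planner-plan-lens3-ValiantsHypothesis-barrier-0 2026-08-17T02:19:18Z):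
its hypotheses are this route's items and its conclusion the sub-problem Statement (glue_lint), and it elaborates with this file. -/

@[closes "route-ValiantsHypothesis-LacunarySymmetroid"] theorem closes (hMDR : MatrixDescartes) (hT : PencilTransfer) (hW : ThetaWitness) :
    _root_.ValiantsHypothesis := by
  show Literature.Computability.AlgebraicComplexity.VP ℂ ≠ Literature.Computability.AlgebraicComplexity.VNP ℂ
  intro hEq
  obtain ⟨Θ, d, hVNP, n₀, hroots⟩ := hW
  have hVP : Literature.Computability.AlgebraicComplexity.IsVPFamily
      (fun n => MvPolynomial.map (algebraMap ℝ ℂ) (Θ n)) := by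
    have hmem := (Literature.Computability.AlgebraicComplexity.mem_VNP_ofFintype_iff_holds _).2 hVNP
    rw [← hEq] at hmem
    exact (Literature.Computability.AlgebraicComplexity.mem_VP_ofFintype_iff_holds _).1 hmem
  obtain ⟨c, hc⟩ := hT (fun n => n) Θ hVP d
  obtain ⟨K₀, hK⟩ := hMDR c 4 (by norm_num)
  obtain ⟨n, hn₀, hnK, hn4⟩ : ∃ n, n₀ ≤ n ∧ K₀ ≤ n ∧ 4 ≤ n := ⟨n₀ + K₀ + 4, by omega, by omega, by omega⟩
  obtain ⟨m, hm, S, hS, hroot⟩ := hc n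
  set Z := (MvPolynomial.aeval (fun i => (Polynomial.X : Polynomial ℝ) ^ d n i) (Θ n)).roots.toFinset.card
    with hZ
  have hm' : m ≤ 2 ^ ((Nat.log 2 (n + 1) + c) ^ c) :=
    hm.trans (Nat.pow_le_pow_right (by norm_num)
      (Nat.pow_le_pow_left (Nat.add_le_add_right (Nat.log_mono_right (Nat.le_succ n)) c) c))
  have h1 := hK (n + 1) m (by omega) hm' (Fin.cons (α := fun _ => ℕ) (0 : ℕ) (d n)) S hS
  rw [hroot] at h1
  have h2 : 2 ^ (n * Nat.log 2 n) ≤ Z + 1 := hroots n hn₀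
  set L := Nat.log 2 n with hL
  have hL2 : 2 ≤ L := by
    rw [hL]
    calc 2 = Nat.log 2 4 := by decide
      _ ≤ Nat.log 2 n := Nat.log_mono_right hn4
  have hLn : L ≤ n := by rw [hL]; exact Nat.log_le_self 2 n
  have hL' : Nat.log 2 (n + 1) ≤ L + 1 := by
    rw [hL]
    calc Nat.log 2 (n + 1) ≤ Nat.log 2 (n * 2) := Nat.log_mono_right (by omega)
      _ = Nat.log 2 n + 1 := Nat.log_mul_base (by norm_num) (by omega)
  have h3 : Z ^ 4 ≤ 2 ^ ((n + 1) * (L + 1)) :=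
    h1.trans (Nat.pow_le_pow_right (by norm_num) (Nat.mul_le_mul_left _ hL'))
  have hnL : 1 ≤ n * L := by nlinarith
  have h4 : 2 ^ (n * L - 1) ≤ Z := by
    have e : 2 ^ (n * L) = 2 * 2 ^ (n * L - 1) := by
      rw [← Nat.pow_succ']
      congr 1
      omega
    have h2' := h2
    rw [e] at h2'
    have : 1 ≤ 2 ^ (n * L - 1) := Nat.one_le_two_pow
    omega
  have h5 : 2 ^ (4 * (n * L - 1)) ≤ Z ^ 4 := by
    rw [pow_mul']
    exact Nat.pow_le_pow_left h4 4
  have h6 : 4 * (n * L - 1) ≤ (n + 1) * (L + 1) :=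
    (Nat.pow_le_pow_iff_right (by norm_num)).1 (h5.trans h3)
  have h7 : 6 * n ≤ 3 * (n * L) := by nlinarith
  have h6' : 4 * (n * L - 1) ≤ n * L + n + L + 1 := by
    have e : (n + 1) * (L + 1) = n * L + n + L + 1 := by ring
    rw [e] at h6
    exact h6
  generalize hP : n * L = P at h6' h7 hnL
  omega

end Summit.ValiantsHypothesis.ValiantsHypothesis.Theses.LacunarySymmetroid
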